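import Summits.AtomisticToContinuum.BoseEinsteinCondensation.Theses.BECRewardDescent
import Literature.MathematicalPhysics.QuantumManyBody.LiebYngvasonTheorem
import Literature.MathematicalPhysics.QuantumManyBody.BoseGasThermodynamicLimitRuelle
import Literature.MathematicalPhysics.QuantumManyBody.BoseGasDirichletWall

/-!
# Route `BECRewardDescent`, crux `RewardScaleChord` (stmt-AtomisticToContinuum-12877),
# line `birth` (`Cruxes/RewardScaleChord/Lines/birth.lean`): the registered stub `stub_energyLower`

Supports (does not close) stmt-AtomisticToContinuum-12877; stub `stub_energyLower` (ENERGY SIDE of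
the chord estimate) of the birth line.

**Thermodynamic-limit form of the Lieb–Yngvason lower bound on the torus.** For every repulsive
finite-range `v` and every `ε > 0` there is `ρ₀ > 0` such that for `0 < ρ < ρ₀` and all large `N`,
with `L = (N/ρ)^{1/3}` and `a` the scattering length,

`E₀^per(N, L) ≥ 4π a ρ (1 - ε) N`.

Proof: the PROVED tree fact `LSSY2005_lowerBound_periodic_holds` ([LSSY2005, Thm. 2.4 (2.35)],
periodic form: `E₀/N ≥ 4πρa(1 − C Y^{1/17})` whenever `Y = 4πρa³/3 < δ` and `C' Y^{-6/17} < L/a`,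
with `ρ = N/L³`, `a ≠ ⊤`), where `a ≠ ⊤` for finite range
(`IsRepulsiveFiniteRange.scatteringLength_ne_top`), `N/L³ = ρ` exactly for `L = (N/ρ)^{1/3}` and
`N ≥ 1` (`sideLength_pow_three`), `Y < δ` and `C Y^{1/17} ≤ ε` for `ρ < ρ₀(v, ε)`
(`exists_density_threshold`: `ρ₀ = min(δ, (ε/C)^17)/(4πa³/3)`), and `C' Y^{-6/17} a < L`
eventually in `N` (`tendsto_sideLength_atTop`). At `a = 0` the left side is `ofReal 0 = 0`.

## References

* [LSSY2005] E. H. Lieb, R. Seiringer, J. P. Solovej, J. Yngvason, *The Mathematics of the Bose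
  Gas and its Condensation*, Birkhäuser 2005 (arXiv:cond-mat/0610117), Thm. 2.4 (2.35).
-/

noncomputable section

open MeasureTheory Filter
open scoped ENNReal

namespace Summit.AtomisticToContinuum.BoseEinsteinCondensation.Theorems.RewardScaleChord

open Literature.MathematicalPhysics.QuantumManyBody.BoseGas

namespace EnergyLower

/-- **Density threshold.** For `K, δ, C, ε > 0` there is `ρ₀ > 0` (namely
`min(δ, (ε/C)^17)/K`) such that every `0 < ρ < ρ₀` has `Kρ < δ` and `C (Kρ)^{1/17} ≤ ε`
(monotonicity of `x ↦ x^{1/17}` and `((ε/C)^17)^{1/17} = ε/C`). [folklore] -/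
theorem exists_density_threshold {K δ C ε : ℝ} (hK : 0 < K) (hδ : 0 < δ) (hC : 0 < C)
    (hε : 0 < ε) :
    ∃ ρ₀ : ℝ, 0 < ρ₀ ∧ ∀ ρ : ℝ, 0 < ρ → ρ < ρ₀ →
      K * ρ < δ ∧ C * (K * ρ) ^ ((1 : ℝ) / 17) ≤ ε := by
  refine ⟨min δ ((ε / C) ^ (17 : ℕ)) / K, by positivity, fun ρ hρ hρlt => ?_⟩
  have hKρ : K * ρ < min δ ((ε / C) ^ (17 : ℕ)) := by
    rw [lt_div_iff₀ hK, mul_comm] at hρlt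
    exact hρlt
  refine ⟨hKρ.trans_le (min_le_left _ _), ?_⟩
  have h1 : K * ρ ≤ (ε / C) ^ (17 : ℕ) := (hKρ.trans_le (min_le_right _ _)).le
  have h2 : (K * ρ) ^ ((1 : ℝ) / 17) ≤ ((ε / C) ^ (17 : ℕ)) ^ ((1 : ℝ) / 17) :=
    Real.rpow_le_rpow (by positivity) h1 (by norm_num)
  have h3 : ((ε / C) ^ (17 : ℕ)) ^ ((1 : ℝ) / 17) = ε / C := by
    rw [show ((1 : ℝ) / 17) = ((17 : ℕ) : ℝ)⁻¹ by norm_num]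
    exact Real.pow_rpow_inv_natCast (by positivity) (by norm_num)
  rw [h3] at h2
  calc C * (K * ρ) ^ ((1 : ℝ) / 17) ≤ C * (ε / C) := mul_le_mul_of_nonneg_left h2 hC.le
    _ = ε := by field_simp

end EnergyLower

/-! ### The stub -/

open EnergyLower in
/-- **Stub `stub_energyLower` of the birth line — ENERGY SIDE: the thermodynamic-limit form of
LSSY Theorem 2.4 on the torus.** For every repulsive finite-range `v` and `ε > 0` there is
`ρ₀ > 0` such that for `0 < ρ < ρ₀`, eventually in `N`,
`ofReal (4π a ρ (1 − ε) N) ≤ E₀^per(N, (N/ρ)^{1/3})` (`a = (scatteringLength v).toReal`).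
From `LSSY2005_lowerBound_periodic_holds` with `N/L³ = ρ` (`sideLength_pow_three`), `Y < δ` and
`C Y^{1/17} ≤ ε` by `exists_density_threshold`, `C' Y^{-6/17} a < L` eventually
(`tendsto_sideLength_atTop`); `a = 0` trivial. [cite: LSSY2005, Thm. 2.4 (2.35)] -/
theorem stub_energyLower :
    ∀ v : ℝ → ENNReal, Literature.MathematicalPhysics.QuantumManyBody.BoseGas.IsRepulsiveFiniteRange v → ∀ ε : ℝ, 0 < ε → ∃ ρ₀ : ℝ, 0 < ρ₀ ∧ ∀ ρ : ℝ, 0 < ρ → ρ < ρ₀ → ∀ᶠ N : ℕ in Filter.atTop, ENNReal.ofReal (4 * Real.pi * (Literature.MathematicalPhysics.QuantumManyBody.BoseGas.scatteringLength v).toReal * ρ * (1 - ε) * N) ≤ Literature.MathematicalPhysics.QuantumManyBody.BoseGas.periodicGroundStateEnergy v N (Literature.MathematicalPhysics.QuantumManyBody.BoseGas.sideLength ρ N) := by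
  intro v hv ε hε
  have hatop : scatteringLength v ≠ ⊤ := hv.scatteringLength_ne_top
  obtain ⟨δ, C, C', hδ, hC, _hC', hLY⟩ := LSSY2005_lowerBound_periodic_holds v hv hatop
  have ha : 0 ≤ (scatteringLength v).toReal := ENNReal.toReal_nonneg
  generalize ha_def : (scatteringLength v).toReal = a at hLY ha ⊢
  rcases ha.eq_or_lt with ha0 | ha_pos
  · -- `a = 0`: the left side is `ofReal 0 = 0`
    subst ha0
    refine ⟨1, one_pos, fun ρ _ _ => Filter.Eventually.of_forall fun N => ?_⟩
    simp
  · -- `a > 0`: LSSY Thm 2.4 at `L = (N/ρ)^{1/3}`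
    have hK : 0 < 4 * Real.pi * a ^ 3 / 3 := by positivity
    obtain ⟨ρ₀, hρ₀, hsmall⟩ := exists_density_threshold hK hδ hC hε
    refine ⟨ρ₀, hρ₀, fun ρ hρ hρlt => ?_⟩
    obtain ⟨hYδ, hCY⟩ := hsmall ρ hρ hρlt
    have hYeq : 4 * Real.pi * a ^ 3 / 3 * ρ = 4 * Real.pi * ρ * a ^ 3 / 3 := by ring
    rw [hYeq] at hYδ hCY
    have hev : ∀ᶠ N : ℕ in atTop,
        C' * (4 * Real.pi * ρ * a ^ 3 / 3) ^ (-(6 : ℝ) / 17) * a < sideLength ρ N :=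
      (tendsto_sideLength_atTop hρ).eventually_gt_atTop _
    filter_upwards [eventually_ge_atTop 1, hev] with N hN hNL
    have hL : 0 < sideLength ρ N := sideLength_pos_of_pos hρ (by omega)
    have hN0 : (N : ℝ) ≠ 0 := Nat.cast_ne_zero.2 (by omega)
    have hρ' : (N : ℝ) / sideLength ρ N ^ 3 = ρ := by
      rw [sideLength_pow_three hρ N]
      field_simp
    have h := hLY N (sideLength ρ N) hL
    dsimp only at h
    rw [hρ'] at h
    have hC'L : C' * (4 * Real.pi * ρ * a ^ 3 / 3) ^ (-(6 : ℝ) / 17) < sideLength ρ N / a := by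
      rw [lt_div_iff₀ ha_pos]
      exact hNL
    refine le_trans (ENNReal.ofReal_le_ofReal ?_) (h hYδ hC'L)
    have h1 : 1 - ε ≤ 1 - C * (4 * Real.pi * ρ * a ^ 3 / 3) ^ ((1 : ℝ) / 17) := by linarith
    have h2 : 0 ≤ 4 * Real.pi * ρ * a * N := by positivity
    calc 4 * Real.pi * a * ρ * (1 - ε) * N = (4 * Real.pi * ρ * a * N) * (1 - ε) := by ring
      _ ≤ (4 * Real.pi * ρ * a * N) * (1 - C * (4 * Real.pi * ρ * a ^ 3 / 3) ^ ((1 : ℝ) / 17)) :=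
          mul_le_mul_of_nonneg_left h1 h2
      _ = 4 * Real.pi * ρ * a * (1 - C * (4 * Real.pi * ρ * a ^ 3 / 3) ^ ((1 : ℝ) / 17)) * N := by
          ring

end Summit.AtomisticToContinuum.BoseEinsteinCondensation.Theorems.RewardScaleChord

end
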